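import Summits.Ventures.PercRepro.SMC
import Summits.Ventures.PercRepro.SMCCertificate

/-!
# The SMC principle at `k = 3` and the conjecture row C-004

`SMC3Principle` (`Summits.Ventures.PercRepro.SMC`: every integer `5 × 5` kernel satisfying the
decidable single-merge condition `SMC3` gives a nonnegative quadratic form at every partition law
`G.law3 p a b c`) is proved from single-merge concavity (`quad_nonneg_of_cert`):

* `law3_eq_triLaw`: the engine's five rows `G.partitionEvent ![a, b, c] (rgs3 s)` are the five
  events `G.triEvent a b c s` (transitivity of connectivity);
* `smcCert_of_SMC3`: the six covering pairs of `singleMerges3` give the bilinear bound on all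
  `49` ordered pairs of move vectors (the identity move contributes `0`);
* `smc3Principle : SMC3Principle`, hence `C004_holds : C004` — the cell's conjecture row C-004
  (the pair-sum inequality, in the engine's row form) is a theorem.
-/

namespace PercRepro

open Finset

namespace MultiGraph

variable {E : Type*} [Fintype E] [DecidableEq E] {V : Type*} (G : MultiGraph V E)

omit [Fintype E] [DecidableEq E] in
/-- Row `001` (`ab|c`) is `{a ~ b ∧ b ≁ c}`. -/
theorem partitionEvent_row_ab_c' (a b c : V) :
    G.partitionEvent ![a, b, c] ![0, 0, 1] = G.connEvent a b ∩ G.sepEvent b c := by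
  ext ω
  obtain ⟨h1, h2, h3⟩ := G.conn_three_trans a b c (ω := ω)
  simp only [mem_partitionEvent_three, Set.mem_inter_iff, mem_connEvent, mem_sepEvent]
  simp
  tauto

omit [Fintype E] [DecidableEq E] in
/-- Row `012` (`a|b|c`) is `{a ≁ b ∧ b ≁ c ∧ a ≁ c}`. -/
theorem partitionEvent_row_a_b_c' (a b c : V) :
    G.partitionEvent ![a, b, c] ![0, 1, 2] =
      G.sepEvent a b ∩ G.sepEvent b c ∩ G.sepEvent a c := by
  ext ω
  simp only [mem_partitionEvent_three, Set.mem_inter_iff, mem_sepEvent]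
  simp
  tauto

/-- The engine's law vector `law3` is the vector of probabilities of the five events
`triEvent`. -/
theorem law3_eq_triLaw (p : E → ℝ) (a b c : V) : G.law3 p a b c = G.triLaw p a b c := by
  funext s
  fin_cases s
  · show prob p (G.partitionEvent ![a, b, c] ![0, 0, 0]) = _
    rw [partitionEvent_row_abc]
    rfl
  · show prob p (G.partitionEvent ![a, b, c] ![0, 0, 1]) = _
    rw [partitionEvent_row_ab_c']
    rfl
  · show prob p (G.partitionEvent ![a, b, c] ![0, 1, 0]) = _
    rw [partitionEvent_row_ac_b]
    rfl
  · show prob p (G.partitionEvent ![a, b, c] ![0, 1, 1]) = _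
    rw [partitionEvent_row_bc_a]
    rfl
  · show prob p (G.partitionEvent ![a, b, c] ![0, 1, 2]) = _
    rw [partitionEvent_row_a_b_c']
    rfl

/-- Every move vector is `e_τ - e_σ` for the identity (`σ = τ`) or a covering pair
`(σ, τ) ∈ singleMerges3`. -/
theorem Move.ivec_eq (mv : Move) :
    ∃ σ τ : Fin 5, (σ = τ ∨ (σ, τ) ∈ singleMerges3) ∧
      mv.ivec = fun i => (if i = τ then 1 else 0) - (if i = σ then 1 else 0) := by
  cases mv <;> decide

end MultiGraph

/-- The integer bilinear form on two differences of unit vectors. -/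
theorem ibilin_sub_single (A : Fin 5 → Fin 5 → ℤ) (σ τ σ' τ' : Fin 5) :
    ibilin A (fun i => (if i = τ then 1 else 0) - (if i = σ then 1 else 0))
      (fun j => (if j = τ' then 1 else 0) - (if j = σ' then 1 else 0)) =
      A τ τ' - A τ σ' - A σ τ' + A σ σ' := by
  unfold ibilin
  simp only [mul_sub, Finset.sum_sub_distrib, mul_ite, mul_one, mul_zero, Finset.sum_ite_eq',
    Finset.mem_univ, if_true]
  ring

/-- The `SMC3` condition (six covering pairs) implies the move certificate (`49` ordered pairs
of move vectors; identity moves contribute `0`). -/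
theorem smcCert_of_SMC3 {A : Matrix (Fin 5) (Fin 5) ℤ} (h : SMC3 A) :
    MultiGraph.SMCCert A := by
  refine ⟨h.1, fun mv mv' => ?_⟩
  obtain ⟨σ, τ, hστ, hv⟩ := MultiGraph.Move.ivec_eq mv
  obtain ⟨σ', τ', hστ', hv'⟩ := MultiGraph.Move.ivec_eq mv'
  rw [hv, hv', ibilin_sub_single]
  rcases hστ with rfl | hm
  · exact le_of_eq (by ring)
  rcases hστ' with rfl | hm'
  · exact le_of_eq (by ring)
  simpa using h.2 (σ, τ) hm (σ', τ') hm'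

/-- **The SMC principle at `k = 3`** holds: every `SMC3` kernel gives a nonnegative quadratic
form at every partition law of three marked vertices. -/
theorem smc3Principle : SMC3Principle := by
  intro A hA V E _ _ G p hp a b c
  have h := G.quad_nonneg_of_cert A (smcCert_of_SMC3 hA) p hp a b c
  rw [← MultiGraph.law3_eq_triLaw] at h
  exact h

/-- **C-004 (the pair-sum inequality, engine row form) is a theorem.** -/
theorem C004_holds : C004 := C004_of_SMC3Principle smc3Principle

/-- C-004 in connection-event form. -/
theorem C004conn_holds : C004conn := C004_iff_C004conn.1 C004_holds

end PercRepro
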